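import Mathlib
import Summits.Ventures.PercRepro2.HCov
import Summits.Ventures.PercRepro2.RootLeafUPocketGraph
import Summits.Ventures.PercRepro2.RootLeafUPocketShare
import Summits.Ventures.PercRepro2.RootLeafUPocket3Graph
import Summits.Ventures.PercRepro2.RootLeafUPocket3Sep
import Summits.Ventures.PercRepro2.RootLeafUPocket3Tp

/-!
# The boundary-`{u, a₂, c}` pocket at `b`: the six `T′`-world masses (blind cell PercRepro2, p4 g18;
S3 (G4-u) item (ae), proofs/P4-G18-PDTHRESHOLD.md §6; no definitions)

From the split `T′ = (T′₀ × W₁) ⊔ (PD₀ × W₁cu)` of RootLeafUPocket3Tp and the independence of the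
outside and pocket parts (`Pocket.prob_off_inter_inn`):
`t′ = t′₀·W₁ + D₀·W₁cu`, `P(T′,oK) = T′₀oK·W₁ + PD₀oK·W₁cu`, `P(T′,bK) = t′₀·W[W₁, a₂~b] + D₀·W[W₁cu, a₂~b]`,
`P(T′,bL) = t′₀·W[W₁, u~b ∨ c~b] + D₀·W[W₁cu, u~b ∨ c~b]`, and the two `o ∈ K` refinements
(`prob_Tp_eq`, `prob_Tp_oK_eq`, `prob_Tp_bK_eq`, `prob_Tp_bL_eq`, `prob_Tp_oK_bK_eq`, `prob_Tp_oK_bL_eq`).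
-/

namespace Summit.Ventures.PercRepro2

open UnionCluster

namespace RootLeafU

namespace Pocket3

variable {V : Type*} {E : Type*}

section TpMasses

variable {ends : E → Sym2 V} {P : Set V} {u a₂ c b : V} {off inn : Config E → Config E}
variable [Fintype E] [DecidableEq E] {R : Type*} [CommRing R] (p : E → R)

/-- The general `T′` mass split: `P(T′ ∩ {off ∈ A} ∩ {inn ∈ B}) = P(T′₀ ∩ A)·W[W₁ ∩ B] + P(PD₀ ∩ A)·W[W₁cu ∩ B]`. -/
theorem prob_Tp_split (hP : ∀ e y z, ends e = s(y, z) → y ∈ P → z ∈ P ∨ z = u ∨ z = a₂ ∨ z = c)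
    (hoff : (∀ ω e, e ∈ touches ends P → off ω e = false) ∧ (∀ ω e, e ∉ touches ends P → off ω e = ω e))
    (hinn : (∀ ω e, e ∈ touches ends P → inn ω e = ω e) ∧ (∀ ω e, e ∉ touches ends P → inn ω e = false))
    (hu : u ∉ P) (ha : a₂ ∉ P) (hc : c ∉ P) (A B : Set (Config E)) :
    prob p (TEvent ends a₂ u c ∩ ({ω : Config E | off ω ∈ A} ∩ {ω : Config E | inn ω ∈ B})) =
      prob p {ω : Config E | off ω ∈ TEvent ends a₂ u c ∩ A} *
        prob p {ω : Config E | inn ω ∈ {ω' : Config E | ¬ Conn ends ω' u a₂ ∧ ¬ Conn ends ω' c a₂} ∩ B} +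
      prob p {ω : Config E | off ω ∈ PDEvent ends u a₂ c ∩ A} *
        prob p {ω : Config E | inn ω ∈ {ω' : Config E | (¬ Conn ends ω' u a₂ ∧ ¬ Conn ends ω' c a₂) ∧ Conn ends ω' c u} ∩ B} := by
  rw [Tp_inter_eq hP hoff hinn hu ha hc A B, prob_union_of_disjoint p (Tp_pieces_disjoint A B),
    Pocket.prob_off_inter_inn p hoff hinn, Pocket.prob_off_inter_inn p hoff hinn]

/-- `t′ = t′₀ · W₁ + D₀ · W₁cu`. -/
theorem prob_Tp_eq (hP : ∀ e y z, ends e = s(y, z) → y ∈ P → z ∈ P ∨ z = u ∨ z = a₂ ∨ z = c)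
    (hoff : (∀ ω e, e ∈ touches ends P → off ω e = false) ∧ (∀ ω e, e ∉ touches ends P → off ω e = ω e))
    (hinn : (∀ ω e, e ∈ touches ends P → inn ω e = ω e) ∧ (∀ ω e, e ∉ touches ends P → inn ω e = false))
    (hu : u ∉ P) (ha : a₂ ∉ P) (hc : c ∉ P) :
    prob p (TEvent ends a₂ u c) =
      prob p {ω : Config E | off ω ∈ TEvent ends a₂ u c} *
        prob p {ω : Config E | inn ω ∈ {ω' : Config E | ¬ Conn ends ω' u a₂ ∧ ¬ Conn ends ω' c a₂}} +
      prob p {ω : Config E | off ω ∈ PDEvent ends u a₂ c} *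
        prob p {ω : Config E | inn ω ∈ {ω' : Config E | (¬ Conn ends ω' u a₂ ∧ ¬ Conn ends ω' c a₂) ∧ Conn ends ω' c u}} := by
  conv_lhs => rw [Tp_eq_inter_univ (off := off) (inn := inn)]
  rw [prob_Tp_split p hP hoff hinn hu ha hc]
  simp only [Set.inter_univ]

/-- `P(T′, oK) = T′₀oK · W₁ + PD₀oK · W₁cu`. -/
theorem prob_Tp_oK_eq (hP : ∀ e y z, ends e = s(y, z) → y ∈ P → z ∈ P ∨ z = u ∨ z = a₂ ∨ z = c)
    (hoff : (∀ ω e, e ∈ touches ends P → off ω e = false) ∧ (∀ ω e, e ∉ touches ends P → off ω e = ω e))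
    (hinn : (∀ ω e, e ∈ touches ends P → inn ω e = ω e) ∧ (∀ ω e, e ∉ touches ends P → inn ω e = false))
    (hu : u ∉ P) (ha : a₂ ∉ P) (hc : c ∉ P) {o : V} (ho : o ∉ P) :
    prob p (TEvent ends a₂ u c ∩ connEvent ends a₂ o) =
      prob p {ω : Config E | off ω ∈ TEvent ends a₂ u c ∩ connEvent ends a₂ o} *
        prob p {ω : Config E | inn ω ∈ {ω' : Config E | ¬ Conn ends ω' u a₂ ∧ ¬ Conn ends ω' c a₂}} +
      prob p {ω : Config E | off ω ∈ PDEvent ends u a₂ c ∩ connEvent ends a₂ o} *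
        prob p {ω : Config E | inn ω ∈ {ω' : Config E | (¬ Conn ends ω' u a₂ ∧ ¬ Conn ends ω' c a₂) ∧ Conn ends ω' c u}} := by
  conv_lhs => rw [Tp_oK_eq hP hoff hinn ha ho]
  rw [prob_Tp_split p hP hoff hinn hu ha hc]
  simp only [Set.inter_univ]

/-- `P(T′, bK) = t′₀ · W[W₁, a₂ ~ b] + D₀ · W[W₁cu, a₂ ~ b]`. -/
theorem prob_Tp_bK_eq (hP : ∀ e y z, ends e = s(y, z) → y ∈ P → z ∈ P ∨ z = u ∨ z = a₂ ∨ z = c)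
    (hoff : (∀ ω e, e ∈ touches ends P → off ω e = false) ∧ (∀ ω e, e ∉ touches ends P → off ω e = ω e))
    (hinn : (∀ ω e, e ∈ touches ends P → inn ω e = ω e) ∧ (∀ ω e, e ∉ touches ends P → inn ω e = false))
    (hu : u ∉ P) (ha : a₂ ∉ P) (hc : c ∉ P) (hb : b ∈ P) :
    prob p (TEvent ends a₂ u c ∩ connEvent ends a₂ b) =
      prob p {ω : Config E | off ω ∈ TEvent ends a₂ u c} *
        prob p {ω : Config E | inn ω ∈ {ω' : Config E | ¬ Conn ends ω' u a₂ ∧ ¬ Conn ends ω' c a₂} ∩ connEvent ends a₂ b} +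
      prob p {ω : Config E | off ω ∈ PDEvent ends u a₂ c} *
        prob p {ω : Config E | inn ω ∈ {ω' : Config E | (¬ Conn ends ω' u a₂ ∧ ¬ Conn ends ω' c a₂) ∧ Conn ends ω' c u} ∩ connEvent ends a₂ b} := by
  conv_lhs => rw [Tp_bK_eq hP hoff hinn ha hb]
  rw [prob_Tp_split p hP hoff hinn hu ha hc]
  simp only [Set.inter_univ]

/-- `P(T′, bL) = t′₀ · W[W₁, u ~ b ∨ c ~ b] + D₀ · W[W₁cu, u ~ b ∨ c ~ b]`. -/
theorem prob_Tp_bL_eq (hP : ∀ e y z, ends e = s(y, z) → y ∈ P → z ∈ P ∨ z = u ∨ z = a₂ ∨ z = c)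
    (hoff : (∀ ω e, e ∈ touches ends P → off ω e = false) ∧ (∀ ω e, e ∉ touches ends P → off ω e = ω e))
    (hinn : (∀ ω e, e ∈ touches ends P → inn ω e = ω e) ∧ (∀ ω e, e ∉ touches ends P → inn ω e = false))
    (hu : u ∉ P) (ha : a₂ ∉ P) (hc : c ∉ P) (hb : b ∈ P) :
    prob p (TEvent ends a₂ u c ∩ connEvent ends u b) =
      prob p {ω : Config E | off ω ∈ TEvent ends a₂ u c} *
        prob p {ω : Config E | inn ω ∈ {ω' : Config E | ¬ Conn ends ω' u a₂ ∧ ¬ Conn ends ω' c a₂} ∩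
          (connEvent ends u b ∪ connEvent ends c b)} +
      prob p {ω : Config E | off ω ∈ PDEvent ends u a₂ c} *
        prob p {ω : Config E | inn ω ∈ {ω' : Config E | (¬ Conn ends ω' u a₂ ∧ ¬ Conn ends ω' c a₂) ∧ Conn ends ω' c u} ∩
          (connEvent ends u b ∪ connEvent ends c b)} := by
  conv_lhs => rw [Tp_bL_eq hP hoff hinn hu hc hb]
  rw [prob_Tp_split p hP hoff hinn hu ha hc]
  simp only [Set.inter_univ]

/-- `P(T′, oK, bK) = T′₀oK · W[W₁, a₂ ~ b] + PD₀oK · W[W₁cu, a₂ ~ b]`. -/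
theorem prob_Tp_oK_bK_eq (hP : ∀ e y z, ends e = s(y, z) → y ∈ P → z ∈ P ∨ z = u ∨ z = a₂ ∨ z = c)
    (hoff : (∀ ω e, e ∈ touches ends P → off ω e = false) ∧ (∀ ω e, e ∉ touches ends P → off ω e = ω e))
    (hinn : (∀ ω e, e ∈ touches ends P → inn ω e = ω e) ∧ (∀ ω e, e ∉ touches ends P → inn ω e = false))
    (hu : u ∉ P) (ha : a₂ ∉ P) (hc : c ∉ P) (hb : b ∈ P) {o : V} (ho : o ∉ P) :
    prob p (TEvent ends a₂ u c ∩ (connEvent ends a₂ o ∩ connEvent ends a₂ b)) =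
      prob p {ω : Config E | off ω ∈ TEvent ends a₂ u c ∩ connEvent ends a₂ o} *
        prob p {ω : Config E | inn ω ∈ {ω' : Config E | ¬ Conn ends ω' u a₂ ∧ ¬ Conn ends ω' c a₂} ∩ connEvent ends a₂ b} +
      prob p {ω : Config E | off ω ∈ PDEvent ends u a₂ c ∩ connEvent ends a₂ o} *
        prob p {ω : Config E | inn ω ∈ {ω' : Config E | (¬ Conn ends ω' u a₂ ∧ ¬ Conn ends ω' c a₂) ∧ Conn ends ω' c u} ∩ connEvent ends a₂ b} := by
  conv_lhs => rw [Tp_oK_bK_eq hP hoff hinn ha hb ho]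
  rw [prob_Tp_split p hP hoff hinn hu ha hc]

/-- `P(T′, oK, bL) = T′₀oK · W[W₁, u ~ b ∨ c ~ b] + PD₀oK · W[W₁cu, u ~ b ∨ c ~ b]`. -/
theorem prob_Tp_oK_bL_eq (hP : ∀ e y z, ends e = s(y, z) → y ∈ P → z ∈ P ∨ z = u ∨ z = a₂ ∨ z = c)
    (hoff : (∀ ω e, e ∈ touches ends P → off ω e = false) ∧ (∀ ω e, e ∉ touches ends P → off ω e = ω e))
    (hinn : (∀ ω e, e ∈ touches ends P → inn ω e = ω e) ∧ (∀ ω e, e ∉ touches ends P → inn ω e = false))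
    (hu : u ∉ P) (ha : a₂ ∉ P) (hc : c ∉ P) (hb : b ∈ P) {o : V} (ho : o ∉ P) :
    prob p (TEvent ends a₂ u c ∩ (connEvent ends a₂ o ∩ connEvent ends u b)) =
      prob p {ω : Config E | off ω ∈ TEvent ends a₂ u c ∩ connEvent ends a₂ o} *
        prob p {ω : Config E | inn ω ∈ {ω' : Config E | ¬ Conn ends ω' u a₂ ∧ ¬ Conn ends ω' c a₂} ∩
          (connEvent ends u b ∪ connEvent ends c b)} +
      prob p {ω : Config E | off ω ∈ PDEvent ends u a₂ c ∩ connEvent ends a₂ o} *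
        prob p {ω : Config E | inn ω ∈ {ω' : Config E | (¬ Conn ends ω' u a₂ ∧ ¬ Conn ends ω' c a₂) ∧ Conn ends ω' c u} ∩
          (connEvent ends u b ∪ connEvent ends c b)} := by
  conv_lhs => rw [Tp_oK_bL_eq hP hoff hinn hu ha hc hb ho]
  rw [prob_Tp_split p hP hoff hinn hu ha hc]

end TpMasses

end Pocket3

end RootLeafU

end Summit.Ventures.PercRepro2
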